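import Summits.QuantumFields.YangMills.Theorems.BalabanUVNodesN11NodeFacesOfSupplyChainTokensAtWitness
import Summits.QuantumFields.YangMills.Theorems.BalabanUVNodesN11Sect3SupplyChainZero

/-!
# DAG node N11 — THE WINDOWED TOKEN FAMILIES OF THE OPERAND-ROWS ROADS and their node faces through this seat's road-agnostic sockets: (§1) dag-n11-e's Gaussian-certificate
# operand-rows road (`SupplierObligations` + def-T's `OperandRowsAlongChain`), (§2) the general-`θ` residual-rows road (`ZhUnity` + dag-n11-d's witness-free `ResidualRows` +
# operand rows), (§3) dag-n11-w3's TermRows road (`SupplierTermRows` ⇒ operand rows) — each ASKED ON THE WINDOWED RUNS ONLY —, (§4) the windowed `h11` child at `θᴳ`, and (§5)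
# the ALL-𝐓-ABSENT road (dag-n11-e's ZERO supplier): the socket binder `hN` INHABITED BY A THEOREM — N11's node and `h11` child with NO supplier hypothesis at all

HEADER — WORK-UNIT METADATA.  Cell `pub-ymgap`, YM-PLAN Track A (HUMAN RULING D-0062 ∕ D-0149 width seats), seat `pub-ymgap-dag-n11-w1` (g4; WIDTH SEAT 1 of 4 on NODE
n11 [B14]), route `BalabanUVNodes` rev 29, KEY item K1⁹ `StabilityBRunRowsAtRecordR13SepCoPHV` = stmt-QuantumFields-27364 (dag-lead KEY MAP v2; helper lane, `--kind proof
--supports 27364 --as helper`, count-neutral; seat payload key K1⁷ 20542 = MIS-KEY fallback).  [III] = [Balaban1988Convergent], [V] = [Balaban1989LargeFieldII], [IV] =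
[Balaban1989LargeFieldI], [I] = [Balaban1987RG1].  Over this seat's `…N11NodeFacesOfSupplyChainTokens` (sockets `b14_main_leavesP_all_of_supplyChainAt_family`,
`thm1Printed_datumOfRecord₁₃SepCoPH_of_supplyChainAt_family`, `h11Family_of_supplyChainAt_family`) and `…AtWitness` (`h11Family_gaussPinH_ofHistoryBlind_theta13OfThm1CCMW_of_supplyChainAt_family`), dag-n11-e `…Sect3SupplyChainObligationsDefs` (`SupplyChainAt`, `SupplierObligations`,
`OperandRowsAlongChain`, `ResidualRows`, `noExpansionObligation_of_gaussCert_of_operandRows`, `noExpansionObligation_of_residualRows_of_operandRows`), dag-n11-w3 `…Sect3SupplyChainTermRows`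
(`SupplierTermRows`, `operandRowsAlongChain_of_supplierTermRows`), dag-n11-e `…Sect3SupplyChainZero` (`zeroSupplier`, `supplierObligations_zeroSupplier_of_forall_absent`,
`operandRowsAlongChain_zeroSupplier`, `isFluctLocal_zero`), dag-n11-w6 `…N11K1WitnessGaussPinH` (`θᴳ`), this seat's `…GaussianCertificateDefs` (`gaussPinH_ζ0 ∕ _quad`, `provisos₁₃CoPH_gaussPinH`).

WHY THIS FILE.  The operand-rows roads of the tree (dag-n11-e's §3c at a Gaussian certificate; the general residual-rows road; dag-n11-w3's TermRows road feeding them) were typed with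
ALL-RUNS binders `∀ P, SupplierObligations θ P (σ P)` ∕ `∀ P, OperandRowsAlongChain θ P (σ P)` wherever a ∀-run face was wanted (dag-n11-e `…NodeAtNumerics`, dag-n11-w6
`…N11K1WitnessGaussPinH`: «window unread, `γ₁₁ := 1`»).  Print's §3 delivers its terms and their bounds for SMALL COUPLINGS only ([III] Thm 1's hypothesis; [I] Thm 1 p.259), so the
faithful ∀-run binder keys every supplier row on the window `Step.InInterval γ P.K (gOfRecord₁₃ θ P)`.  THIS FILE types the three roads' WINDOWED token families
`∀ P, Step.InInterval γ P.K (gOfRecord₁₃ θ P) → SupplyChainAt θ P` and runs them through this seat's sockets: N11's node at every run of any world bound to the datum with `w.γ ≤ γ`,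
`B16.Thm1Printed` at the SepCoPH datum, and dag-n24-c's `h11`-shaped child — (§4) the latter also at dag-n11-w6's certificate `θᴳ` of K1's witness (their `N11_h11_gaussPinH_…_of_obligations_of_operandRows`
with the window READ).

WHAT THIS FILE PROVES (theorems only, 0 `def`, 0 `sorry`; standard axioms; compositions BY NAME).
§1 (Gaussian-class `θ`, operand rows) ★ `supplyChainAt_family_of_gaussCert_of_operandRows` · ★★ `b14_main_leavesP_all_of_gaussCert_of_operandRows` · ★★
   `thm1Printed_datumOfRecord₁₃SepCoPH_of_gaussCert_of_operandRows` · ★★★ `h11Family_of_gaussCert_of_operandRows`.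
§2 (general `θ`, `ZhUnity`, residual rows + operand rows) ★ `supplyChainAt_family_of_residualRows_of_operandRows` · ★★ `b14_main_leavesP_all_of_residualRows_of_operandRows` · ★★
   `thm1Printed_datumOfRecord₁₃SepCoPH_of_residualRows_of_operandRows` · ★★★ `h11Family_of_residualRows_of_operandRows`.
§3 (Gaussian-class `θ`, dag-n11-w3's term rows) ★ `supplyChainAt_family_of_gaussCert_of_supplierTermRows` · ★★★ `h11Family_of_gaussCert_of_supplierTermRows`.
§4 (`θᴳ`) ★★★ `h11Family_gaussPinH_ofHistoryBlind_theta13OfThm1CCMW_of_operandRows_windowed`.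
§5 (Gaussian-class `θ`, ZERO supplier; per windowed run every expansion child 𝐓-absent) ★★ `supplyChainAt_family_of_gaussCert_of_forall_absent` · ★★★
   `b14_main_leavesP_all_of_gaussCert_of_forall_absent` · ★★★ `h11Family_of_gaussCert_of_forall_absent` (NO supplier hypothesis; companions of dag-n11-w1 g0's `…BorelBZero` printed faces).

HONEST FRAMING.  Helper lane of K1⁹; count-neutral KERNEL COMPOSITION of landed theorems; `SupplierObligations` ([III] §3 ∕ Thm 2 proper — XL, nobody's theorem), def-T's operand rows,
dag-n11-d's residual rows, dag-n11-w3's term rows, the certificate and the keys are DISPLAYED HYPOTHESES, inhabited at no `θ` here; nothing of Bałaban asserted.  No v9 stub touched;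
K1⁹ NOT closed; N11 NOT discharged; counts unmoved (typed 28∕28 · discharged 5∕27 · A 5∕28).  One finite `𝕋⁴_{L^K}` programme at fixed `ε = L^{−K}`; R4 closes only the conditional
finite-𝕋⁴ rung `BalabanLadder.UV` — NOT ℝ⁴, NOT OS, NOT a mass gap, NOT Clay.  No `sorry`, `axiom`, `def`, `instance`, `notation`.
Sources (SHAPE ∕ bookkeeping only): [III] Thm 1 p.262, Theorem p.245, remark p.262, p.244 L36–38, §3 p.279, (2.20)–(2.23) p.258, (3.1) p.264, (3.16)–(3.23) pp.268–270,
(3.24)–(3.25) p.270; [V] Thm 1 + (0.1) pp.355–356; [IV] (0.2)–(0.4) p.176, p.177 (i)–(ii); [I] Thm 1 p.259, (0.20) p.256.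
-/

noncomputable section

open MeasureTheory TopologicalSpace
open scoped BigOperators ENNReal NNReal Matrix.Norms.L2Operator

namespace Summit.QuantumFields.YangMills.Theorems.BalabanUVNodesN11NodeFacesOfSupplyChainTokensOperandRoads

open Literature.MathematicalPhysics.QuantumFieldTheory.Balaban1983to89 T4Continuum T4NestedCovariance Node00 Node00.Tk DagBinding
open B15DeterminingSets B8Eq17ClassAkV1 B14.Eq218Concrete B10Eq42TorusConstraint Step
open BalabanUVNodesN11HistoryPinnedResidualDefs BalabanUVNodesN11RePinnedParamDefs
open BalabanUVNodesN11GaussianCertificateDefs (gaussPinH gaussPinH_ζ0 gaussPinH_quad provisos₁₃CoPH_gaussPinH)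
open BalabanUVNodesN11Sect3SupplyChainDefs
open BalabanUVNodesN11Sect3SupplyChainObligationsDefs
open BalabanUVNodesN11Sect3SupplyChainTermRows (SupplierTermRows operandRowsAlongChain_of_supplierTermRows)
open BalabanUVNodesN11Sect3SupplyChainZero (zeroSupplier isFluctLocal_zero supplierObligations_zeroSupplier_of_forall_absent operandRowsAlongChain_zeroSupplier)
open BalabanUVNodesN11Sect3SupplyChainNodeAtNumerics (one_le_M_stage12NumericsOfThm1CCMW)
open BalabanUVNodesN11NodeFacesOfSupplyChainTokens
open BalabanUVNodesN11NodeFacesOfSupplyChainTokensAtWitness (h11Family_gaussPinH_ofHistoryBlind_theta13OfThm1CCMW_of_supplyChainAt_family)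

variable {F : T4Family} {N : ℕ} [NeZero N]

/-! ## §1  dag-n11-e's operand-rows road at a Gaussian certificate, windowed -/

section OperandRows

variable (θ : Stage13HParams F N)

/-- **★ THE WINDOWED TOKEN FAMILY ON dag-n11-e's OPERAND-ROWS ROAD** at any `θ` of the Gaussian-certificate class (`hζ`, `hq`), core provisos, `1 ≤ M`: per windowed run [III] §3's
supplier `σ P` with `SupplierObligations` (its locality (loc) serves the clause) and def-T's `OperandRowsAlongChain θ P (σ P)` — `noExpansionObligation_of_gaussCert_of_operandRows`
per run; NO `ZhUnity`, NO residual row, NO K0b row, NO run guard. [cite: Balaban1988Convergent, Theorem p.245, Thm 1 p.262, §3 p.279, (3.23)–(3.25) p.270, (2.20)–(2.23) p.258; Balaban1987RG1, Thm 1 p.259] -/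
theorem supplyChainAt_family_of_gaussCert_of_operandRows
    (hζ : ∀ (p : B12.RunParams) (n : ℕ) (Ω Λ : ℕ → Set (Site (F.P p.K) 0)), (θ.Zh p n Ω Λ).ζ0 = (ZhPinOfRecord₁₃ θ.toStage13Params p Ω Λ).ζ0)
    (hq : ∀ (p : B12.RunParams) (n : ℕ) (Ω Λ : ℕ → Set (Site (F.P p.K) 0)) (j : ℕ) (Λ' : Set (Site (F.P p.K) 0)) (ω : MultiCfg (F.P p.K) (SU N) (FluctV N)),
      (θ.Zh p n Ω Λ).quad j Λ' ω = ∑ b ∈ (Set.toFinite (bondsIn j (Λ'ᶜ ∩ Ω (j + 1)))).toFinset, ‖(ω j).2 b‖ ^ 2)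
    (h : θ.Provisos₁₃CoPH F N) (hM : 1 ≤ θ.τ9.M) {γ : ℝ} (σ : (P : B12.RunParams) → Sect3Supplier θ P)
    (hσ : ∀ P : B12.RunParams, Step.InInterval γ P.K (gOfRecord₁₃ F N θ.toStage13Params P) → SupplierObligations θ P (σ P))
    (hops : ∀ P : B12.RunParams, Step.InInterval γ P.K (gOfRecord₁₃ F N θ.toStage13Params P) → OperandRowsAlongChain θ P (σ P)) :
    ∀ P : B12.RunParams, Step.InInterval γ P.K (gOfRecord₁₃ F N θ.toStage13Params P) → SupplyChainAt θ P := fun P hw =>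
  ⟨σ P, hσ P hw, noExpansionObligation_of_gaussCert_of_operandRows hζ hq h hM (σ P) (hσ P hw).loc (hops P hw)⟩

/-- **★★ N11's DAG NODE AT EVERY RUN ON THE OPERAND-ROWS ROAD, WINDOWED** — `∀ P, Dag.B14_main (leavesP w P)` at any world bound to the CoPH datum of a Gaussian-class `θ` with
`w.γ ≤ γ`, on the live-selector line (admissibility, `0 ≤ κ ∕ E₀ ∕ B₀`, `1 ≤ M`), from the windowed supplier + operand rows (§1 through this seat's socket).
[cite: Balaban1988Convergent, Thm 1 p.262, Theorem p.245, p.244 L36–38, §3 p.279, (3.23)–(3.25) p.270; Balaban1989LargeFieldII, Introduction pp.355–356; Balaban1989LargeFieldI, (0.3)–(0.4) p.176, p.177 (i)–(ii)] -/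
theorem b14_main_leavesP_all_of_gaussCert_of_operandRows
    (hζ : ∀ (p : B12.RunParams) (n : ℕ) (Ω Λ : ℕ → Set (Site (F.P p.K) 0)), (θ.Zh p n Ω Λ).ζ0 = (ZhPinOfRecord₁₃ θ.toStage13Params p Ω Λ).ζ0)
    (hq : ∀ (p : B12.RunParams) (n : ℕ) (Ω Λ : ℕ → Set (Site (F.P p.K) 0)) (j : ℕ) (Λ' : Set (Site (F.P p.K) 0)) (ω : MultiCfg (F.P p.K) (SU N) (FluctV N)),
      (θ.Zh p n Ω Λ).quad j Λ' ω = ∑ b ∈ (Set.toFinite (bondsIn j (Λ'ᶜ ∩ Ω (j + 1)))).toFinset, ‖(ω j).2 b‖ ^ 2)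
    (h : θ.Provisos₁₃CoPH F N) (hsel : θ.ppSel = ppSelLiveOfRecord F N θ.ν θ.τ9 (EOfRecord₁₃ F N θ.toStage13Params) (wOfRecord₉ F N θ.toStage9Params))
    (hθ : θ.Admissible F N) (hκ : 0 ≤ θ.s2.lf.κ) (hE₀ : 0 ≤ θ.s2.lf.E₀) (hB₀ : 0 ≤ θ.s2.lf.B₀) (hM : 1 ≤ θ.τ9.M) {γ : ℝ} (σ : (P : B12.RunParams) → Sect3Supplier θ P)
    (hσ : ∀ P : B12.RunParams, Step.InInterval γ P.K (gOfRecord₁₃ F N θ.toStage13Params P) → SupplierObligations θ P (σ P))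
    (hops : ∀ P : B12.RunParams, Step.InInterval γ P.K (gOfRecord₁₃ F N θ.toStage13Params P) → OperandRowsAlongChain θ P (σ P))
    (w : WorldP) (hC : w.C = (datumOfRecord₁₃CoPH F N θ h).C) (hγw : w.γ ≤ γ) : ∀ P : B12.RunParams, Dag.B14_main (leavesP w P) :=
  b14_main_leavesP_all_of_supplyChainAt_family θ h hsel hθ hκ hE₀ hB₀ hM (supplyChainAt_family_of_gaussCert_of_operandRows θ hζ hq h hM σ hσ hops) w hC hγw

/-- **★★ N11's PRINTED FACE `B16.Thm1Printed (datumOfRecord₁₃SepCoPH F N θ h).C` ON THE OPERAND-ROWS ROAD, WINDOWED** (`0 < γ`; the window printed is `]0, γ]`).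
[cite: Balaban1988Convergent, Thm 1 p.262, Theorem p.245, p.244 L36–38, §3 p.279, (3.16) p.268, (3.23)–(3.25) p.270; Balaban1989LargeFieldII, Thm 1 p.355; Balaban1989LargeFieldI, (0.3)–(0.4) p.176] -/
theorem thm1Printed_datumOfRecord₁₃SepCoPH_of_gaussCert_of_operandRows
    (hζ : ∀ (p : B12.RunParams) (n : ℕ) (Ω Λ : ℕ → Set (Site (F.P p.K) 0)), (θ.Zh p n Ω Λ).ζ0 = (ZhPinOfRecord₁₃ θ.toStage13Params p Ω Λ).ζ0)
    (hq : ∀ (p : B12.RunParams) (n : ℕ) (Ω Λ : ℕ → Set (Site (F.P p.K) 0)) (j : ℕ) (Λ' : Set (Site (F.P p.K) 0)) (ω : MultiCfg (F.P p.K) (SU N) (FluctV N)),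
      (θ.Zh p n Ω Λ).quad j Λ' ω = ∑ b ∈ (Set.toFinite (bondsIn j (Λ'ᶜ ∩ Ω (j + 1)))).toFinset, ‖(ω j).2 b‖ ^ 2)
    (h : θ.Provisos₁₃SepCoPH F N) (hsel : θ.ppSel = ppSelLiveOfRecord F N θ.ν θ.τ9 (EOfRecord₁₃ F N θ.toStage13Params) (wOfRecord₉ F N θ.toStage9Params))
    (hθ : θ.Admissible F N) (hκ : 0 ≤ θ.s2.lf.κ) (hE₀ : 0 ≤ θ.s2.lf.E₀) (hB₀ : 0 ≤ θ.s2.lf.B₀) (hM : 1 ≤ θ.τ9.M) {γ : ℝ} (hγ : 0 < γ)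
    (σ : (P : B12.RunParams) → Sect3Supplier θ P)
    (hσ : ∀ P : B12.RunParams, Step.InInterval γ P.K (gOfRecord₁₃ F N θ.toStage13Params P) → SupplierObligations θ P (σ P))
    (hops : ∀ P : B12.RunParams, Step.InInterval γ P.K (gOfRecord₁₃ F N θ.toStage13Params P) → OperandRowsAlongChain θ P (σ P)) :
    B16.Thm1Printed (datumOfRecord₁₃SepCoPH F N θ h).C :=
  thm1Printed_datumOfRecord₁₃SepCoPH_of_supplyChainAt_family θ h hsel hθ hκ hE₀ hB₀ hM hγ
    (supplyChainAt_family_of_gaussCert_of_operandRows θ hζ hq h.toCore hM σ hσ hops)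

/-- **★★★ THE `h11`-SHAPED (S1ᵀ) FAMILY OF THE K1⁹-BY-NAME ROAD ON THE OPERAND-ROWS ROAD, WINDOWED** (`γ₁₁ := γ`, any `0 < γ`; SepCoPH datum; only `smallCouplings` read — dag-n11-e ∕
dag-n11-w6's ALL-RUNS `hT` binder replaced by the windowed supplier rows). [cite: Balaban1988Convergent, Theorem p.245, Thm 1 p.262, remark p.262, p.244 L36–38, §3 p.279, (3.23)–(3.25) p.270; Balaban1989LargeFieldII, Thm 1 + (0.1) pp.355–356; Balaban1989LargeFieldI, (0.3)–(0.4) p.176, p.177 (i)–(ii)] -/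
theorem h11Family_of_gaussCert_of_operandRows
    (hζ : ∀ (p : B12.RunParams) (n : ℕ) (Ω Λ : ℕ → Set (Site (F.P p.K) 0)), (θ.Zh p n Ω Λ).ζ0 = (ZhPinOfRecord₁₃ θ.toStage13Params p Ω Λ).ζ0)
    (hq : ∀ (p : B12.RunParams) (n : ℕ) (Ω Λ : ℕ → Set (Site (F.P p.K) 0)) (j : ℕ) (Λ' : Set (Site (F.P p.K) 0)) (ω : MultiCfg (F.P p.K) (SU N) (FluctV N)),
      (θ.Zh p n Ω Λ).quad j Λ' ω = ∑ b ∈ (Set.toFinite (bondsIn j (Λ'ᶜ ∩ Ω (j + 1)))).toFinset, ‖(ω j).2 b‖ ^ 2)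
    (h : θ.Provisos₁₃SepCoPH F N) (hsel : θ.ppSel = ppSelLiveOfRecord F N θ.ν θ.τ9 (EOfRecord₁₃ F N θ.toStage13Params) (wOfRecord₉ F N θ.toStage9Params))
    (hθ : θ.Admissible F N) (hκ : 0 ≤ θ.s2.lf.κ) (hE₀ : 0 ≤ θ.s2.lf.E₀) (hB₀ : 0 ≤ θ.s2.lf.B₀) (hM : 1 ≤ θ.τ9.M) {γ : ℝ} (hγ : 0 < γ)
    (σ : (P : B12.RunParams) → Sect3Supplier θ P)
    (hσ : ∀ P : B12.RunParams, Step.InInterval γ P.K (gOfRecord₁₃ F N θ.toStage13Params P) → SupplierObligations θ P (σ P))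
    (hops : ∀ P : B12.RunParams, Step.InInterval γ P.K (gOfRecord₁₃ F N θ.toStage13Params P) → OperandRowsAlongChain θ P (σ P)) :
    ∀ βup β₀ : ℝ, ∃ γ₁₁ : ℝ, 0 < γ₁₁ ∧ ∀ w : WorldP, w.C = (datumOfRecord₁₃SepCoPH F N θ h).C → w.βup = βup → w.β₀ = β₀ → w.γ ≤ γ₁₁ →
      ∀ P : B12.RunParams, (leavesP w P).b7 → (leavesP w P).b8 → (leavesP w P).b9 → (leavesP w P).b10 → (leavesP w P).b11 →
      (leavesP w P).smallCouplings → (leavesP w P).smallFieldInductive → (leavesP w P).flowControl →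
        ∀ k, k < P.K → SLaw₁₃CoPH F N θ P k → TLaw₁₃CoPH F N θ P k :=
  h11Family_of_supplyChainAt_family θ h hsel hθ hκ hE₀ hB₀ hM hγ (supplyChainAt_family_of_gaussCert_of_operandRows θ hζ hq h.toCore hM σ hσ hops)

end OperandRows

/-! ## §2  The residual-rows road at a general `θ` (`ZhUnity`), windowed -/

section ResidualRows

variable (θ : Stage13HParams F N)

/-- **★ THE WINDOWED TOKEN FAMILY ON THE RESIDUAL-ROWS ROAD AT A GENERAL `θ`** (no certificate): core provisos, `ZhUnity`, `1 ≤ M`, and per windowed run the supplier `σ P` with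
`SupplierObligations`, dag-n11-d's witness-free `ResidualRows θ P` (pins, measurability, K0b's A-fibre domination) and def-T's `OperandRowsAlongChain θ P (σ P)` —
`noExpansionObligation_of_residualRows_of_operandRows` per run. [cite: Balaban1988Convergent, Theorem p.245, Thm 1 p.262, §3 p.279, (3.1) p.264, (3.16)–(3.23) pp.268–270, (3.24)–(3.25) p.270; Balaban1989LargeFieldI, (0.2)–(0.3) p.176; Balaban1987RG1, Thm 1 p.259] -/
theorem supplyChainAt_family_of_residualRows_of_operandRows (h : θ.Provisos₁₃CoPH F N) (hU : θ.ZhUnity F N) (hM : 1 ≤ θ.τ9.M) {γ : ℝ}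
    (σ : (P : B12.RunParams) → Sect3Supplier θ P)
    (hσ : ∀ P : B12.RunParams, Step.InInterval γ P.K (gOfRecord₁₃ F N θ.toStage13Params P) → SupplierObligations θ P (σ P))
    (hres : ∀ P : B12.RunParams, Step.InInterval γ P.K (gOfRecord₁₃ F N θ.toStage13Params P) → ResidualRows θ P)
    (hops : ∀ P : B12.RunParams, Step.InInterval γ P.K (gOfRecord₁₃ F N θ.toStage13Params P) → OperandRowsAlongChain θ P (σ P)) :
    ∀ P : B12.RunParams, Step.InInterval γ P.K (gOfRecord₁₃ F N θ.toStage13Params P) → SupplyChainAt θ P := fun P hw =>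
  ⟨σ P, hσ P hw, noExpansionObligation_of_residualRows_of_operandRows h hU hM (σ P) (hσ P hw).loc (hres P hw) (hops P hw)⟩

/-- **★★ N11's DAG NODE AT EVERY RUN ON THE RESIDUAL-ROWS ROAD AT A GENERAL `θ`, WINDOWED** — any world bound to the CoPH datum with `w.γ ≤ γ`, live-selector line.
[cite: Balaban1988Convergent, Thm 1 p.262, Theorem p.245, p.244 L36–38, §3 p.279, (3.16)–(3.25) pp.268–270; Balaban1989LargeFieldII, Introduction pp.355–356; Balaban1989LargeFieldI, (0.3)–(0.4) p.176, p.177 (i)–(ii)] -/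
theorem b14_main_leavesP_all_of_residualRows_of_operandRows (h : θ.Provisos₁₃CoPH F N) (hU : θ.ZhUnity F N)
    (hsel : θ.ppSel = ppSelLiveOfRecord F N θ.ν θ.τ9 (EOfRecord₁₃ F N θ.toStage13Params) (wOfRecord₉ F N θ.toStage9Params))
    (hθ : θ.Admissible F N) (hκ : 0 ≤ θ.s2.lf.κ) (hE₀ : 0 ≤ θ.s2.lf.E₀) (hB₀ : 0 ≤ θ.s2.lf.B₀) (hM : 1 ≤ θ.τ9.M) {γ : ℝ} (σ : (P : B12.RunParams) → Sect3Supplier θ P)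
    (hσ : ∀ P : B12.RunParams, Step.InInterval γ P.K (gOfRecord₁₃ F N θ.toStage13Params P) → SupplierObligations θ P (σ P))
    (hres : ∀ P : B12.RunParams, Step.InInterval γ P.K (gOfRecord₁₃ F N θ.toStage13Params P) → ResidualRows θ P)
    (hops : ∀ P : B12.RunParams, Step.InInterval γ P.K (gOfRecord₁₃ F N θ.toStage13Params P) → OperandRowsAlongChain θ P (σ P))
    (w : WorldP) (hC : w.C = (datumOfRecord₁₃CoPH F N θ h).C) (hγw : w.γ ≤ γ) : ∀ P : B12.RunParams, Dag.B14_main (leavesP w P) :=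
  b14_main_leavesP_all_of_supplyChainAt_family θ h hsel hθ hκ hE₀ hB₀ hM (supplyChainAt_family_of_residualRows_of_operandRows θ h hU hM σ hσ hres hops) w hC hγw

/-- **★★ N11's PRINTED FACE `B16.Thm1Printed (datumOfRecord₁₃SepCoPH F N θ h).C` ON THE RESIDUAL-ROWS ROAD AT A GENERAL `θ`, WINDOWED** (`0 < γ`).
[cite: Balaban1988Convergent, Thm 1 p.262, Theorem p.245, p.244 L36–38, §3 p.279, (3.16)–(3.25) pp.268–270; Balaban1989LargeFieldII, Thm 1 p.355; Balaban1989LargeFieldI, (0.3)–(0.4) p.176] -/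
theorem thm1Printed_datumOfRecord₁₃SepCoPH_of_residualRows_of_operandRows (h : θ.Provisos₁₃SepCoPH F N) (hU : θ.ZhUnity F N)
    (hsel : θ.ppSel = ppSelLiveOfRecord F N θ.ν θ.τ9 (EOfRecord₁₃ F N θ.toStage13Params) (wOfRecord₉ F N θ.toStage9Params))
    (hθ : θ.Admissible F N) (hκ : 0 ≤ θ.s2.lf.κ) (hE₀ : 0 ≤ θ.s2.lf.E₀) (hB₀ : 0 ≤ θ.s2.lf.B₀) (hM : 1 ≤ θ.τ9.M) {γ : ℝ} (hγ : 0 < γ)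
    (σ : (P : B12.RunParams) → Sect3Supplier θ P)
    (hσ : ∀ P : B12.RunParams, Step.InInterval γ P.K (gOfRecord₁₃ F N θ.toStage13Params P) → SupplierObligations θ P (σ P))
    (hres : ∀ P : B12.RunParams, Step.InInterval γ P.K (gOfRecord₁₃ F N θ.toStage13Params P) → ResidualRows θ P)
    (hops : ∀ P : B12.RunParams, Step.InInterval γ P.K (gOfRecord₁₃ F N θ.toStage13Params P) → OperandRowsAlongChain θ P (σ P)) :
    B16.Thm1Printed (datumOfRecord₁₃SepCoPH F N θ h).C :=
  thm1Printed_datumOfRecord₁₃SepCoPH_of_supplyChainAt_family θ h hsel hθ hκ hE₀ hB₀ hM hγ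
    (supplyChainAt_family_of_residualRows_of_operandRows θ h.toCore hU hM σ hσ hres hops)

/-- **★★★ THE `h11`-SHAPED (S1ᵀ) FAMILY ON THE RESIDUAL-ROWS ROAD AT A GENERAL `θ`, WINDOWED** (`γ₁₁ := γ`, `0 < γ`; SepCoPH datum; only `smallCouplings` read).
[cite: Balaban1988Convergent, Theorem p.245, Thm 1 p.262, remark p.262, p.244 L36–38, §3 p.279, (3.16)–(3.25) pp.268–270; Balaban1989LargeFieldII, Thm 1 + (0.1) pp.355–356; Balaban1989LargeFieldI, (0.3)–(0.4) p.176, p.177 (i)–(ii)] -/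
theorem h11Family_of_residualRows_of_operandRows (h : θ.Provisos₁₃SepCoPH F N) (hU : θ.ZhUnity F N)
    (hsel : θ.ppSel = ppSelLiveOfRecord F N θ.ν θ.τ9 (EOfRecord₁₃ F N θ.toStage13Params) (wOfRecord₉ F N θ.toStage9Params))
    (hθ : θ.Admissible F N) (hκ : 0 ≤ θ.s2.lf.κ) (hE₀ : 0 ≤ θ.s2.lf.E₀) (hB₀ : 0 ≤ θ.s2.lf.B₀) (hM : 1 ≤ θ.τ9.M) {γ : ℝ} (hγ : 0 < γ)
    (σ : (P : B12.RunParams) → Sect3Supplier θ P)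
    (hσ : ∀ P : B12.RunParams, Step.InInterval γ P.K (gOfRecord₁₃ F N θ.toStage13Params P) → SupplierObligations θ P (σ P))
    (hres : ∀ P : B12.RunParams, Step.InInterval γ P.K (gOfRecord₁₃ F N θ.toStage13Params P) → ResidualRows θ P)
    (hops : ∀ P : B12.RunParams, Step.InInterval γ P.K (gOfRecord₁₃ F N θ.toStage13Params P) → OperandRowsAlongChain θ P (σ P)) :
    ∀ βup β₀ : ℝ, ∃ γ₁₁ : ℝ, 0 < γ₁₁ ∧ ∀ w : WorldP, w.C = (datumOfRecord₁₃SepCoPH F N θ h).C → w.βup = βup → w.β₀ = β₀ → w.γ ≤ γ₁₁ →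
      ∀ P : B12.RunParams, (leavesP w P).b7 → (leavesP w P).b8 → (leavesP w P).b9 → (leavesP w P).b10 → (leavesP w P).b11 →
      (leavesP w P).smallCouplings → (leavesP w P).smallFieldInductive → (leavesP w P).flowControl →
        ∀ k, k < P.K → SLaw₁₃CoPH F N θ P k → TLaw₁₃CoPH F N θ P k :=
  h11Family_of_supplyChainAt_family θ h hsel hθ hκ hE₀ hB₀ hM hγ (supplyChainAt_family_of_residualRows_of_operandRows θ h.toCore hU hM σ hσ hres hops)

end ResidualRows

/-! ## §3  dag-n11-w3's TermRows road at a Gaussian certificate, windowed -/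

section TermRows

variable (θ : Stage13HParams F N)

/-- **★ THE WINDOWED TOKEN FAMILY ON dag-n11-w3's TermRows ROAD** at any Gaussian-class `θ`: per windowed run the supplier `σ P` with `SupplierObligations` and def-T's six term rows along
its chain, `SupplierTermRows θ P (σ P)` (⇒ the operand rows, `operandRowsAlongChain_of_supplierTermRows`); core provisos, `1 ≤ M`.  The term rows ask GLOBAL 𝐄 ∕ 𝐁 bounds (uniform in
`g′ ∈ ℝ` resp. the fluctuation) — a genuine §3 supplier meets them with the cutoff built into its term values (dag-n11-w1 g3 LOCATED). [cite: Balaban1988Convergent, Theorem p.245, Thm 1 p.262, §3 p.279, (2.23)–(2.27) pp.258–259, (3.16)–(3.21) pp.268–269, (3.23)–(3.25) p.270; Balaban1987RG1, Thm 1 p.259] -/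
theorem supplyChainAt_family_of_gaussCert_of_supplierTermRows
    (hζ : ∀ (p : B12.RunParams) (n : ℕ) (Ω Λ : ℕ → Set (Site (F.P p.K) 0)), (θ.Zh p n Ω Λ).ζ0 = (ZhPinOfRecord₁₃ θ.toStage13Params p Ω Λ).ζ0)
    (hq : ∀ (p : B12.RunParams) (n : ℕ) (Ω Λ : ℕ → Set (Site (F.P p.K) 0)) (j : ℕ) (Λ' : Set (Site (F.P p.K) 0)) (ω : MultiCfg (F.P p.K) (SU N) (FluctV N)),
      (θ.Zh p n Ω Λ).quad j Λ' ω = ∑ b ∈ (Set.toFinite (bondsIn j (Λ'ᶜ ∩ Ω (j + 1)))).toFinset, ‖(ω j).2 b‖ ^ 2)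
    (h : θ.Provisos₁₃CoPH F N) (hM : 1 ≤ θ.τ9.M) {γ : ℝ} (σ : (P : B12.RunParams) → Sect3Supplier θ P)
    (hσ : ∀ P : B12.RunParams, Step.InInterval γ P.K (gOfRecord₁₃ F N θ.toStage13Params P) → SupplierObligations θ P (σ P))
    (hT : ∀ P : B12.RunParams, Step.InInterval γ P.K (gOfRecord₁₃ F N θ.toStage13Params P) → SupplierTermRows θ P (σ P)) :
    ∀ P : B12.RunParams, Step.InInterval γ P.K (gOfRecord₁₃ F N θ.toStage13Params P) → SupplyChainAt θ P :=
  supplyChainAt_family_of_gaussCert_of_operandRows θ hζ hq h hM σ hσ fun P hw => operandRowsAlongChain_of_supplierTermRows (hT P hw)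

/-- **★★★ THE `h11`-SHAPED (S1ᵀ) FAMILY ON dag-n11-w3's TermRows ROAD, WINDOWED** (`γ₁₁ := γ`, `0 < γ`; SepCoPH datum; live-selector line); N11's node ∀ runs and `B16.Thm1Printed` on
this road are §1's faces at `hops := operandRowsAlongChain_of_supplierTermRows ∘ hT`. [cite: Balaban1988Convergent, Theorem p.245, Thm 1 p.262, remark p.262, p.244 L36–38, §3 p.279, (2.23)–(2.27) pp.258–259, (3.16)–(3.25) pp.268–270; Balaban1989LargeFieldII, Thm 1 + (0.1) pp.355–356; Balaban1989LargeFieldI, (0.3)–(0.4) p.176] -/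
theorem h11Family_of_gaussCert_of_supplierTermRows
    (hζ : ∀ (p : B12.RunParams) (n : ℕ) (Ω Λ : ℕ → Set (Site (F.P p.K) 0)), (θ.Zh p n Ω Λ).ζ0 = (ZhPinOfRecord₁₃ θ.toStage13Params p Ω Λ).ζ0)
    (hq : ∀ (p : B12.RunParams) (n : ℕ) (Ω Λ : ℕ → Set (Site (F.P p.K) 0)) (j : ℕ) (Λ' : Set (Site (F.P p.K) 0)) (ω : MultiCfg (F.P p.K) (SU N) (FluctV N)),
      (θ.Zh p n Ω Λ).quad j Λ' ω = ∑ b ∈ (Set.toFinite (bondsIn j (Λ'ᶜ ∩ Ω (j + 1)))).toFinset, ‖(ω j).2 b‖ ^ 2)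
    (h : θ.Provisos₁₃SepCoPH F N) (hsel : θ.ppSel = ppSelLiveOfRecord F N θ.ν θ.τ9 (EOfRecord₁₃ F N θ.toStage13Params) (wOfRecord₉ F N θ.toStage9Params))
    (hθ : θ.Admissible F N) (hκ : 0 ≤ θ.s2.lf.κ) (hE₀ : 0 ≤ θ.s2.lf.E₀) (hB₀ : 0 ≤ θ.s2.lf.B₀) (hM : 1 ≤ θ.τ9.M) {γ : ℝ} (hγ : 0 < γ)
    (σ : (P : B12.RunParams) → Sect3Supplier θ P)
    (hσ : ∀ P : B12.RunParams, Step.InInterval γ P.K (gOfRecord₁₃ F N θ.toStage13Params P) → SupplierObligations θ P (σ P))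
    (hT : ∀ P : B12.RunParams, Step.InInterval γ P.K (gOfRecord₁₃ F N θ.toStage13Params P) → SupplierTermRows θ P (σ P)) :
    ∀ βup β₀ : ℝ, ∃ γ₁₁ : ℝ, 0 < γ₁₁ ∧ ∀ w : WorldP, w.C = (datumOfRecord₁₃SepCoPH F N θ h).C → w.βup = βup → w.β₀ = β₀ → w.γ ≤ γ₁₁ →
      ∀ P : B12.RunParams, (leavesP w P).b7 → (leavesP w P).b8 → (leavesP w P).b9 → (leavesP w P).b10 → (leavesP w P).b11 →
      (leavesP w P).smallCouplings → (leavesP w P).smallFieldInductive → (leavesP w P).flowControl →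
        ∀ k, k < P.K → SLaw₁₃CoPH F N θ P k → TLaw₁₃CoPH F N θ P k :=
  h11Family_of_supplyChainAt_family θ h hsel hθ hκ hE₀ hB₀ hM hγ (supplyChainAt_family_of_gaussCert_of_supplierTermRows θ hζ hq h.toCore hM σ hσ hT)

end TermRows

/-! ## §4  At dag-n11-w6's certificate `θᴳ` of K1's witness: the windowed `h11` child on the operand-rows road -/

section Certificate

variable {j : ℕ} {γ ε₀ ε₂₉ B₃ B₃' a₀ a₁ : ℝ} (Zr : (q : B12.RunParams) → TkResidualW F N (FluctV N) q.K)

/-- **★★★ N11's CHILD FAMILY IN dag-n24-c's `h11` SHAPE AT `θᴳ`'s SepCoPH DATUM ON THE OPERAND-ROWS ROAD, WINDOWED** — dag-n11-w6's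
`N11_h11_gaussPinH_ofHistoryBlind_theta13OfThm1CCMW_of_obligations_of_operandRows` with its ALL-RUNS binders `hσ ∕ hops : ∀ P, …` REPLACED by the windowed ones (per run in
`]0, γ′]` of the record's couplings), `γ₁₁ := γ′` (theirs: `γ₁₁ := 1`, window unread); any door proof `hG`; window `0 < γ ≤ ½` + six signs; `θᴳ.toStage13Params = θ₁₅ᶜᶜᴹᵂ` (`rfl`).
[cite: Balaban1988Convergent, Theorem p.245, Thm 1 p.262, remark p.262, p.244 L36–38, §3 p.279, (3.16)–(3.25) pp.268–270, (2.21) p.258; Balaban1989LargeFieldII, Thm 1 + (0.1) pp.355–356; Balaban1987RG1, Thm 1 p.259; Balaban1989LargeFieldI, (0.2)–(0.4) p.176] -/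
theorem h11Family_gaussPinH_ofHistoryBlind_theta13OfThm1CCMW_of_operandRows_windowed (hγ₀ : 0 < γ) (hγh : γ ≤ 1 / 2) (hε : 0 < ε₀) (hε' : 0 < ε₂₉)
    (hB : 0 ≤ B₃) (hB' : 0 ≤ B₃') (ha₀ : 0 < a₀) (ha₁ : 0 < a₁)
    (hG : (gaussPinH (Stage13HParams.ofHistoryBlind F N ⟨theta13OfThm1CCMW F N j γ ε₀ ε₂₉ B₃ B₃' a₀ a₁, Zr⟩)).Provisos₁₃SepCoPH F N) {γ' : ℝ} (hγ' : 0 < γ')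
    (σ : (P : B12.RunParams) → Sect3Supplier (gaussPinH (Stage13HParams.ofHistoryBlind F N ⟨theta13OfThm1CCMW F N j γ ε₀ ε₂₉ B₃ B₃' a₀ a₁, Zr⟩)) P)
    (hσ : ∀ P : B12.RunParams, Step.InInterval γ' P.K (gOfRecord₁₃ F N (theta13OfThm1CCMW F N j γ ε₀ ε₂₉ B₃ B₃' a₀ a₁) P) →
      SupplierObligations (gaussPinH (Stage13HParams.ofHistoryBlind F N ⟨theta13OfThm1CCMW F N j γ ε₀ ε₂₉ B₃ B₃' a₀ a₁, Zr⟩)) P (σ P))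
    (hops : ∀ P : B12.RunParams, Step.InInterval γ' P.K (gOfRecord₁₃ F N (theta13OfThm1CCMW F N j γ ε₀ ε₂₉ B₃ B₃' a₀ a₁) P) →
      OperandRowsAlongChain (gaussPinH (Stage13HParams.ofHistoryBlind F N ⟨theta13OfThm1CCMW F N j γ ε₀ ε₂₉ B₃ B₃' a₀ a₁, Zr⟩)) P (σ P)) :
    ∀ βup β₀ : ℝ, ∃ γ₁₁ : ℝ, 0 < γ₁₁ ∧ ∀ w : WorldP,
      w.C = (datumOfRecord₁₃SepCoPH F N (gaussPinH (Stage13HParams.ofHistoryBlind F N ⟨theta13OfThm1CCMW F N j γ ε₀ ε₂₉ B₃ B₃' a₀ a₁, Zr⟩)) hG).C →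
      w.βup = βup → w.β₀ = β₀ → w.γ ≤ γ₁₁ → ∀ P : B12.RunParams, (leavesP w P).b7 → (leavesP w P).b8 → (leavesP w P).b9 → (leavesP w P).b10 → (leavesP w P).b11 →
      (leavesP w P).smallCouplings → (leavesP w P).smallFieldInductive → (leavesP w P).flowControl →
        ∀ k, k < P.K → SLaw₁₃CoPH F N (gaussPinH (Stage13HParams.ofHistoryBlind F N ⟨theta13OfThm1CCMW F N j γ ε₀ ε₂₉ B₃ B₃' a₀ a₁, Zr⟩)) P k →
          TLaw₁₃CoPH F N (gaussPinH (Stage13HParams.ofHistoryBlind F N ⟨theta13OfThm1CCMW F N j γ ε₀ ε₂₉ B₃ B₃' a₀ a₁, Zr⟩)) P k :=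
  h11Family_gaussPinH_ofHistoryBlind_theta13OfThm1CCMW_of_supplyChainAt_family Zr hγ₀ hγh hε hε' hB hB' ha₀ ha₁ hG hγ'
    (supplyChainAt_family_of_gaussCert_of_operandRows (gaussPinH (Stage13HParams.ofHistoryBlind F N ⟨theta13OfThm1CCMW F N j γ ε₀ ε₂₉ B₃ B₃' a₀ a₁, Zr⟩))
      (gaussPinH_ζ0 _) (gaussPinH_quad _) hG.toCore (one_le_M_stage12NumericsOfThm1CCMW F j γ ε₀ B₃ B₃' a₀ a₁) σ hσ hops)

end Certificate

/-! ## §5  THE ALL-𝐓-ABSENT ROAD: the zero supplier inhabits the socket binder — node and `h11` child with NO supplier hypothesis -/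

section Absent

variable (θ : Stage13HParams F N)

/-- **★★ THE WINDOWED TOKEN FAMILY ON THE ALL-𝐓-ABSENT ROAD — `hN` INHABITED BY A THEOREM**: at any `θ` of the Gaussian-certificate class (`hζ`, `hq`), core provisos, `0 ≤ E₀`,
`1 ≤ M`: on every windowed run ALL of whose expansion children are 𝐓-absent (`habs`: `Ω_{k+1}(s′) ≠ ∅ ⇒ 𝐓ρ_k(s′) ≡ 0`), dag-n11-e's ZERO supplier meets [III] §3's obligations
(`supplierObligations_zeroSupplier_of_forall_absent`) and def-T's operand rows (`operandRowsAlongChain_zeroSupplier`), so the token holds with NO supplier hypothesis.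
[cite: Balaban1988Convergent, Theorem p.245, Thm 1 p.262, (3.1) p.264, (3.24)–(3.25) p.270, (3.16)–(3.21) pp.268–269; Balaban1987RG1, Thm 1 p.259] -/
theorem supplyChainAt_family_of_gaussCert_of_forall_absent
    (hζ : ∀ (p : B12.RunParams) (n : ℕ) (Ω Λ : ℕ → Set (Site (F.P p.K) 0)), (θ.Zh p n Ω Λ).ζ0 = (ZhPinOfRecord₁₃ θ.toStage13Params p Ω Λ).ζ0)
    (hq : ∀ (p : B12.RunParams) (n : ℕ) (Ω Λ : ℕ → Set (Site (F.P p.K) 0)) (j : ℕ) (Λ' : Set (Site (F.P p.K) 0)) (ω : MultiCfg (F.P p.K) (SU N) (FluctV N)),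
      (θ.Zh p n Ω Λ).quad j Λ' ω = ∑ b ∈ (Set.toFinite (bondsIn j (Λ'ᶜ ∩ Ω (j + 1)))).toFinset, ‖(ω j).2 b‖ ^ 2)
    (h : θ.Provisos₁₃CoPH F N) (hE₀ : 0 ≤ θ.s2.lf.E₀) (hM : 1 ≤ θ.τ9.M) {γ : ℝ}
    (habs : ∀ P : B12.RunParams, Step.InInterval γ P.K (gOfRecord₁₃ F N θ.toStage13Params P) → ∀ k, k < P.K →
      ∀ s : SeqOfRecord F θ.ν θ.τ9.M (gOfRecord₁₃ F N θ.toStage13Params P) P.K (k + 1), s.Ω (k + 1) ≠ ∅ →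
        slotsTOfRecord F N θ.ν θ.τ9 (EOfRecord₁₃ F N θ.toStage13Params) (wOfRecord₉ F N θ.toStage9Params) θ.ppSel P (gOfRecord₁₃ F N θ.toStage13Params P) (k + 1) s = 0) :
    ∀ P : B12.RunParams, Step.InInterval γ P.K (gOfRecord₁₃ F N θ.toStage13Params P) → SupplyChainAt θ P := fun P hw =>
  ⟨zeroSupplier θ P, supplierObligations_zeroSupplier_of_forall_absent hE₀ (habs P hw),
    noExpansionObligation_of_gaussCert_of_operandRows hζ hq h hM (zeroSupplier θ P) (fun k _ => isFluctLocal_zero (θ := θ) (p := P) (k + 1))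
      operandRowsAlongChain_zeroSupplier⟩

/-- **★★★ N11's DAG NODE AT EVERY RUN OF A WORLD WHOSE WINDOWED RUNS HAVE NO 𝐓-PRESENT EXPANSION CHILD — NO SUPPLIER HYPOTHESIS** (any world bound to the CoPH datum of a
Gaussian-class `θ` with `w.γ ≤ γ`, live-selector line; companion of dag-n11-w1 g0's printed face `…BorelBZero.thm1Printed_datumOfRecord₁₃CoPH_of_forall_absent_of_gaussCert`): the
socket `b14_main_leavesP_all_of_supplyChainAt_family` on §5's inhabited token family.  A DEGENERATE-WORLD INSTANCE (no small-field expansion step anywhere along the window), recorded as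
the socket layer's witness of non-vacuity in kind — not a claim about the record's worlds. [cite: Balaban1988Convergent, Thm 1 p.262, Theorem p.245, p.244 L36–38, (3.1) p.264, (3.24)–(3.25) p.270; Balaban1989LargeFieldII, Introduction pp.355–356; Balaban1989LargeFieldI, (0.3)–(0.4) p.176, p.177 (i)–(ii)] -/
theorem b14_main_leavesP_all_of_gaussCert_of_forall_absent
    (hζ : ∀ (p : B12.RunParams) (n : ℕ) (Ω Λ : ℕ → Set (Site (F.P p.K) 0)), (θ.Zh p n Ω Λ).ζ0 = (ZhPinOfRecord₁₃ θ.toStage13Params p Ω Λ).ζ0)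
    (hq : ∀ (p : B12.RunParams) (n : ℕ) (Ω Λ : ℕ → Set (Site (F.P p.K) 0)) (j : ℕ) (Λ' : Set (Site (F.P p.K) 0)) (ω : MultiCfg (F.P p.K) (SU N) (FluctV N)),
      (θ.Zh p n Ω Λ).quad j Λ' ω = ∑ b ∈ (Set.toFinite (bondsIn j (Λ'ᶜ ∩ Ω (j + 1)))).toFinset, ‖(ω j).2 b‖ ^ 2)
    (h : θ.Provisos₁₃CoPH F N) (hsel : θ.ppSel = ppSelLiveOfRecord F N θ.ν θ.τ9 (EOfRecord₁₃ F N θ.toStage13Params) (wOfRecord₉ F N θ.toStage9Params))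
    (hθ : θ.Admissible F N) (hκ : 0 ≤ θ.s2.lf.κ) (hE₀ : 0 ≤ θ.s2.lf.E₀) (hB₀ : 0 ≤ θ.s2.lf.B₀) (hM : 1 ≤ θ.τ9.M) {γ : ℝ}
    (habs : ∀ P : B12.RunParams, Step.InInterval γ P.K (gOfRecord₁₃ F N θ.toStage13Params P) → ∀ k, k < P.K →
      ∀ s : SeqOfRecord F θ.ν θ.τ9.M (gOfRecord₁₃ F N θ.toStage13Params P) P.K (k + 1), s.Ω (k + 1) ≠ ∅ →
        slotsTOfRecord F N θ.ν θ.τ9 (EOfRecord₁₃ F N θ.toStage13Params) (wOfRecord₉ F N θ.toStage9Params) θ.ppSel P (gOfRecord₁₃ F N θ.toStage13Params P) (k + 1) s = 0)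
    (w : WorldP) (hC : w.C = (datumOfRecord₁₃CoPH F N θ h).C) (hγw : w.γ ≤ γ) : ∀ P : B12.RunParams, Dag.B14_main (leavesP w P) :=
  b14_main_leavesP_all_of_supplyChainAt_family θ h hsel hθ hκ hE₀ hB₀ hM (supplyChainAt_family_of_gaussCert_of_forall_absent θ hζ hq h hE₀ hM habs) w hC hγw

/-- **★★★ THE `h11`-SHAPED (S1ᵀ) FAMILY ON THE ALL-𝐓-ABSENT ROAD — NO SUPPLIER HYPOTHESIS** (`γ₁₁ := γ`, `0 < γ`; SepCoPH datum; only `smallCouplings` read).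
[cite: Balaban1988Convergent, Theorem p.245, Thm 1 p.262, remark p.262, p.244 L36–38, (3.1) p.264, (3.24)–(3.25) p.270; Balaban1989LargeFieldII, Thm 1 + (0.1) pp.355–356; Balaban1989LargeFieldI, (0.3)–(0.4) p.176, p.177 (i)–(ii)] -/
theorem h11Family_of_gaussCert_of_forall_absent
    (hζ : ∀ (p : B12.RunParams) (n : ℕ) (Ω Λ : ℕ → Set (Site (F.P p.K) 0)), (θ.Zh p n Ω Λ).ζ0 = (ZhPinOfRecord₁₃ θ.toStage13Params p Ω Λ).ζ0)
    (hq : ∀ (p : B12.RunParams) (n : ℕ) (Ω Λ : ℕ → Set (Site (F.P p.K) 0)) (j : ℕ) (Λ' : Set (Site (F.P p.K) 0)) (ω : MultiCfg (F.P p.K) (SU N) (FluctV N)),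
      (θ.Zh p n Ω Λ).quad j Λ' ω = ∑ b ∈ (Set.toFinite (bondsIn j (Λ'ᶜ ∩ Ω (j + 1)))).toFinset, ‖(ω j).2 b‖ ^ 2)
    (h : θ.Provisos₁₃SepCoPH F N) (hsel : θ.ppSel = ppSelLiveOfRecord F N θ.ν θ.τ9 (EOfRecord₁₃ F N θ.toStage13Params) (wOfRecord₉ F N θ.toStage9Params))
    (hθ : θ.Admissible F N) (hκ : 0 ≤ θ.s2.lf.κ) (hE₀ : 0 ≤ θ.s2.lf.E₀) (hB₀ : 0 ≤ θ.s2.lf.B₀) (hM : 1 ≤ θ.τ9.M) {γ : ℝ} (hγ : 0 < γ)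
    (habs : ∀ P : B12.RunParams, Step.InInterval γ P.K (gOfRecord₁₃ F N θ.toStage13Params P) → ∀ k, k < P.K →
      ∀ s : SeqOfRecord F θ.ν θ.τ9.M (gOfRecord₁₃ F N θ.toStage13Params P) P.K (k + 1), s.Ω (k + 1) ≠ ∅ →
        slotsTOfRecord F N θ.ν θ.τ9 (EOfRecord₁₃ F N θ.toStage13Params) (wOfRecord₉ F N θ.toStage9Params) θ.ppSel P (gOfRecord₁₃ F N θ.toStage13Params P) (k + 1) s = 0) :
    ∀ βup β₀ : ℝ, ∃ γ₁₁ : ℝ, 0 < γ₁₁ ∧ ∀ w : WorldP, w.C = (datumOfRecord₁₃SepCoPH F N θ h).C → w.βup = βup → w.β₀ = β₀ → w.γ ≤ γ₁₁ →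
      ∀ P : B12.RunParams, (leavesP w P).b7 → (leavesP w P).b8 → (leavesP w P).b9 → (leavesP w P).b10 → (leavesP w P).b11 →
      (leavesP w P).smallCouplings → (leavesP w P).smallFieldInductive → (leavesP w P).flowControl →
        ∀ k, k < P.K → SLaw₁₃CoPH F N θ P k → TLaw₁₃CoPH F N θ P k :=
  h11Family_of_supplyChainAt_family θ h hsel hθ hκ hE₀ hB₀ hM hγ (supplyChainAt_family_of_gaussCert_of_forall_absent θ hζ hq h.toCore hE₀ hM habs)

end Absent

end Summit.QuantumFields.YangMills.Theorems.BalabanUVNodesN11NodeFacesOfSupplyChainTokensOperandRoads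

end
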